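import Mathlib
import Summits.ValiantsHypothesis.ValiantsHypothesis.Theses.KPlusLogSqLaw
import Summits.ValiantsHypothesis.ValiantsHypothesis.Theorems.LacunarySymmetroidMatrixDescartesCensusTropicalKLaw
import Literature.Computability.AlgebraicComplexity.BurgisserReductionModPrimes

/-!
# Route «KPlusLogSqLaw»: the Descartes mechanism for `Lifting` cannot cover the thin regime unless `TropicalB` fails

HONEST FRAMING.  Helper toward the registered stub `stub_liftThin` of the crux `Lifting`
(`Summit.ValiantsHypothesis.ValiantsHypothesis.Theses.KPlusLogSqLaw.Lifting`, ledger item `stmt-ValiantsHypothesis-19772`,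
route `KPlusLogSqLaw`, object-search cell `pub-symmetroid`).  It LOCATES the stub; it proves neither crux, asserts nothing
about `KPlusLogSqLaw`, `MatrixDescartes` (`stmt-ValiantsHypothesis-18050`) or `VP ≠ VNP`, and its hypothesis
(«counting-tight tropical rows throughout the thin regime») is NOT claimed — it is the mechanism under test.

WHAT IS PROVED.  The only mechanism by which a rung of `Lifting` has been proved so far (K = 2 in the birth file, K = 3 in
progress) is: an explicit tropical family showing the tropical row of format `(m, K)` is counting-tight up to a factor
`2^{C₁ K}` — `TropRootLawAt m K n → C(m+K−1, m) ≤ 2^{C₁K}·(n+1)` — followed by Descartes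
(`Census.realRootLawAt_descartes`: at most `2·C(m+K−1,m) − 1` real zeros).  The theorem
`not_tropicalB_of_countingTightThin` says that this mechanism cannot be available on the WHOLE thin regime
`K ≤ log₂² m` unless the sibling crux `TropicalB` (`stmt-ValiantsHypothesis-19771`) is false: counting-tightness at
`K = (2C+2)·log₂ m` gives `log₂ T(m,K) ≥ (2C+2−o(1))·log₂² m > C·(K + log₂² m)`.  Consequently, inside the window
`log₂ m ≲ K ≤ log₂² m` the stub `stub_liftThin` can only hold through a real-zero bound BELOW Descartes (if `TropicalB`
holds), and the honest landable content of the stub today is the list of fixed-`K` rungs.  The proof is elementary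
arithmetic: `m = 2^L`, `L = 2J`, `J = 2^i`, `K = (2C+2)·L`, the lower bound `(m+1)^{K−1} ≤ (K−1)!·C(m+K−1, m)`
(`Nat.pow_sub_le_descFactorial`), `(K−1)! ≤ (K−1)^{K−1} ≤ (2^J)^{K−1}`, against the budget `2^{C₁K + C(K+L²) + 1}`;
the elementary `2i ≤ 2^i` is reused from `Literature.Computability.AlgebraicComplexity.two_mul_le_two_pow`.
[folklore arithmetic; statement = a located obstruction of the cell, val-sym-lift-p1 2026-08-26, K4FORK-REPORT §0]
-/

-- `Summit.ValiantsHypothesis.ValiantsHypothesis.…` repeats a component by the D-0017 layout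
-- (single-conjunct summit), which the `dupNamespace` linter flags; the name is mandated.
set_option linter.dupNamespace false
set_option autoImplicit false

namespace Summit.ValiantsHypothesis.ValiantsHypothesis.Theorems.KPlusLogSqLaw

open Summit.ValiantsHypothesis.ValiantsHypothesis.Theses.KPlusLogSqLaw (TropicalB)
open Summit.ValiantsHypothesis.ValiantsHypothesis.Theorems.LacunarySymmetroidMatrixDescartes.TropicalCensus (TropRootLawAt)

/-- **Counting-tight tropical rows on the whole thin regime refute `TropicalB`.**  If for some `C₁` every format
`(m, K)` with `K ≤ log₂² m` satisfies `TropRootLawAt m K n → C(m+K−1, m) ≤ 2^{C₁ K}·(n + 1)` (the tropical row is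
Descartes-tight up to `2^{C₁K}`, which is exactly what makes the `Lifting` rung at that format FREE by
`Census.realRootLawAt_descartes`), then the crux `TropicalB` fails.  Located obstruction, not a claim: the hypothesis
is the mechanism of the known `Lifting` rungs extrapolated to the window, and is not asserted. [folklore arithmetic] -/
theorem not_tropicalB_of_countingTightThin (C₁ : ℕ)
    (h : ∀ m K n : ℕ, K ≤ Nat.log 2 m ^ 2 → TropRootLawAt m K n →
      Nat.choose (m + K - 1) m ≤ 2 ^ (C₁ * K) * (n + 1)) :
    ¬ TropicalB := by
  intro hTB
  unfold TropicalB at hTB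
  obtain ⟨C, hC⟩ := hTB
  -- parameters: t = 2C+2, B = 2t(C₁+C)+1, i = B+t+1, J = 2^i, L = 2J, m = 2^L, K = tL, N = 2^{C(K+L²)}
  set t : ℕ := 2 * C + 2 with ht
  set B : ℕ := 2 * t * (C₁ + C) + 1 with hB
  set i : ℕ := B + t + 1 with hi
  set J : ℕ := 2 ^ i with hJ
  set L : ℕ := 2 * J with hL
  set m : ℕ := 2 ^ L with hm
  set K : ℕ := t * L with hK
  set X : ℕ := C₁ * K + C * (K + L ^ 2) + 1 with hX
  set N : ℕ := 2 ^ (C * (K + L ^ 2)) with hN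
  clear_value N X K m L J i B t
  -- sizes
  have hiJ : i < J := by rw [hJ]; exact Nat.lt_two_pow_self
  have ht_pow : t < 2 ^ t := Nat.lt_two_pow_self
  have hJ1 : 1 ≤ J := by rw [hJ]; exact Nat.one_le_two_pow
  have hBJ : B ≤ J := by omega
  have h2t : 2 * t ≤ 2 ^ i := by
    calc 2 * t ≤ 2 * 2 ^ t := by omega
      _ = 2 ^ (t + 1) := by rw [pow_succ]; ring
      _ ≤ 2 ^ i := Nat.pow_le_pow_right (by norm_num) (by omega)
  have htJ : t ≤ J := by
    calc t ≤ 2 * t := by omega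
      _ ≤ 2 ^ i := h2t
      _ = J := by rw [hJ]
  have hK4 : 4 ≤ K := by
    rw [hK, hL]
    calc 4 = 2 * (2 * 1) := by norm_num
      _ ≤ t * (2 * J) := Nat.mul_le_mul (by omega) (by omega)
  have hKL : K ≤ L ^ 2 := by
    rw [hK, hL, sq]
    exact Nat.mul_le_mul_right _ (by omega)
  have hKJ : K ≤ 2 ^ J := by
    have h1 : K = 2 * t * 2 ^ i := by rw [hK, hL, hJ]; ring
    have h2 : 2 * i ≤ 2 ^ i := Literature.Computability.AlgebraicComplexity.two_mul_le_two_pow (by omega)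
    calc K = 2 * t * 2 ^ i := h1
      _ ≤ 2 ^ i * 2 ^ i := Nat.mul_le_mul_right _ h2t
      _ = 2 ^ (2 * i) := by rw [two_mul, pow_add]
      _ ≤ 2 ^ (2 ^ i) := Nat.pow_le_pow_right (by norm_num) h2
      _ = 2 ^ J := by rw [hJ]
  have hlog : Nat.log 2 m = L := by rw [hm, Nat.log_pow (by norm_num)]
  -- the tropical row from TB, and the counting-tight hypothesis
  have hrow : TropRootLawAt m K N := by
    intro d v ε n θ p hε hθ hdom halt
    have := hC m K d v ε n θ p hε hθ hdom halt
    rw [hlog, ← hN] at this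
    exact this
  have hchoose := h m K N (by rw [hlog]; exact hKL) hrow
  -- upper bound of the budget
  have hup : 2 ^ (C₁ * K) * (N + 1) ≤ 2 ^ X := by
    have h1 : N + 1 ≤ 2 ^ (C * (K + L ^ 2) + 1) := by
      have : 1 ≤ N := by rw [hN]; exact Nat.one_le_two_pow
      rw [pow_succ, ← hN]; omega
    calc 2 ^ (C₁ * K) * (N + 1) ≤ 2 ^ (C₁ * K) * 2 ^ (C * (K + L ^ 2) + 1) := Nat.mul_le_mul_left _ h1
      _ = 2 ^ X := by rw [← pow_add, hX]; congr 1
  -- lower bound of the binomial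
  have hlow : (m + 1) ^ (K - 1) ≤ (K - 1).factorial * Nat.choose (m + K - 1) m := by
    have h1 := Nat.pow_sub_le_descFactorial (m + K - 1) (K - 1)
    have e1 : m + K - 1 + 1 - (K - 1) = m + 1 := by omega
    have e3 : m + K - 1 = m + (K - 1) := by omega
    rw [e1, Nat.descFactorial_eq_factorial_mul_choose, e3, ← Nat.choose_symm_add] at h1
    rw [e3]
    exact h1
  have hfac : (K - 1).factorial ≤ (2 ^ J) ^ (K - 1) :=
    calc (K - 1).factorial ≤ (K - 1) ^ (K - 1) := Nat.factorial_le_pow _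
      _ ≤ (2 ^ J) ^ (K - 1) := Nat.pow_le_pow_left (by omega) _
  have hcomb : (m + 1) ^ (K - 1) ≤ (2 ^ J) ^ (K - 1) * 2 ^ X :=
    calc (m + 1) ^ (K - 1) ≤ (K - 1).factorial * Nat.choose (m + K - 1) m := hlow
      _ ≤ (2 ^ J) ^ (K - 1) * (2 ^ (C₁ * K) * (N + 1)) := Nat.mul_le_mul hfac hchoose
      _ ≤ (2 ^ J) ^ (K - 1) * 2 ^ X := Nat.mul_le_mul_left _ hup
  -- the exponent inequality: J(K−1) + X < L(K−1)
  obtain ⟨P, hP⟩ : ∃ P, K = P + 1 := ⟨K - 1, by omega⟩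
  have hPK : K - 1 = P := by omega
  have hexp : J * (K - 1) + X < L * (K - 1) := by
    have hP1 : P + 1 = 2 * t * J := by rw [← hP, hK, hL]; ring
    have hBJJ : B * J ≤ J * J := Nat.mul_le_mul_right _ hBJ
    rw [hPK, hX, hP, hL]
    zify at hP1 hBJJ hJ1 ⊢
    have htz : (t : ℤ) = 2 * C + 2 := by exact_mod_cast ht
    have hBz : (B : ℤ) = 2 * t * (C₁ + C) + 1 := by exact_mod_cast hB
    have hPz : (P : ℤ) = 2 * (2 * C + 2) * J - 1 := by rw [← htz]; linarith
    rw [hBz, htz] at hBJJ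
    rw [hPz]
    nlinarith only [hBJJ, hJ1]
  have hlt : (2 ^ J) ^ (K - 1) * 2 ^ X < (m + 1) ^ (K - 1) :=
    calc (2 ^ J) ^ (K - 1) * 2 ^ X = 2 ^ (J * (K - 1) + X) := by rw [← pow_mul, ← pow_add]
      _ < 2 ^ (L * (K - 1)) := Nat.pow_lt_pow_right (by norm_num) hexp
      _ = (2 ^ L) ^ (K - 1) := by rw [pow_mul]
      _ ≤ (m + 1) ^ (K - 1) := Nat.pow_le_pow_left (by rw [hm]; omega) _
  exact absurd hcomb (not_le.mpr hlt)

end Summit.ValiantsHypothesis.ValiantsHypothesis.Theorems.KPlusLogSqLaw
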